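import Literature.NumberTheory.Automorphic.ArchRankOneOrbitalFamilyParam          -- ★ p851042 (this seat) (B-par) ENGINE frame: `contDiffOn_orbitalIntegral_param`, `fderiv_orbitalIntegral_param_apply`; brings ★ p851003 generic half (`fderiv_iteratedDeriv_slice_eq`)
import Literature.NumberTheory.Automorphic.ArchRankOneJumpZeroCayley                -- ★ (LH10-p02 (g3)): `integral_comp_conj_transport` (the torus point moves with the frame)
import HarnessLib

/-!
# (B-par) ON THE SHARED-DATUM CARRIER `U(J)`, `J = Φ₂`, CAYLEY TORUS — parametric differentiation under the normalised elliptic orbital integral `F(Θ_q)(ψ)`: joint `C^∞` on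
# `sin ψ ≠ 0`, `∂_v` inside the functional, `∂_v` past the normal jets (Harish-Chandra ∕ Varadarajan 1977 I §1.12; Hörmander Thm. 1.1.8–1.1.9; the (β) text asked for by (B-trans))

Topic `NumberTheory/Automorphic`; namespace `Literature.NumberTheory.Automorphic.UnitaryGroup` (carrier `unitaryGroupOfForm (starRingEnd ℂ) J`, `hJ : J = (StdForm.antidiagonal 2).over ℂ`).
THEOREMS ONLY (no `def`, no instance, no notation, no axiom, no named fact, no `sorry`); kernel lane `--kind proof --supports stmt-HodgeConjecture-24833`.  Cell `pub/hodgecm-mathlib`,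
crux H413 (`stmt-HodgeConjecture-24833`), line LH3 (closer stub `stub_N9`), LETTER L1 clause (I₃), SPEC-I3 v1.1 brick **(B-par)**, CAYLEY EDITION (F0P3a-p04 (g24); companion of ★
p851042; (I₃) spec-owner F0P3a-p08 (g23) 2026-09-02T10:29:14Z «β»): the (B-desc) heads of record — ★ `exists_descent_normalLine_orbFamGExt` (normal line) and ★ p851016 `exists_descent_box_chartOrbG` (product neighbourhood) —
hand the word induction (B-trans) the integral `∫_{U(J)} f (c, ↑↑(h · P diag(e^{iθ₀}, e^{iθ₂}) P⁻¹ · h⁻¹)) dμ₀` on the SHARED-DATUM carrier with the CAYLEY torus; (B-par) is served there.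

THE MATHEMATICS.  `P = (1 1; 1 −1)`, `P̄ᵀ J P = diag(2, −2)` (★ `formCongr_cayleyTwo_of_eq_over`), so `e : h′ ↦ P h′ P⁻¹` is a topological-group isomorphism from the ENGINE carrier
`U(diag(2,−2))(ℂ)` — spelled `U((diag ![2,−2]).map σ_{w₀})` for a complex place `w₀` of the field `ℂ` itself (§1 (0): `ℂ` HAS a complex place, and `σ_{w₀}` fixes `±2`), so that ★
p851042 and the ★ `(L, a, w)`-frame lemmas apply with `L := ℂ` and NO number-field binder leaks into a `U(J)` statement — onto `U(J)`; for every measure `μ` on `U(J)`, every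
`f` and torus point (★ `integral_comp_conj_transport`):  `∫_{U(J)} f(↑↑(h · P t P⁻¹ · h⁻¹)) dμ = ∫_{U(D)} (f ∘ Ad_P)(↑↑(h′ t h′⁻¹)) d(μ.map e⁻¹)`.  A family `Θ` is read as `Θ_P q X := Θ q (P X P⁻¹)`
on the engine carrier (again jointly `C^∞`, ONE compact support `P⁻¹ C P`), `∂_v (Θ_P) = (∂_v Θ)_P` literally, and every engine-frame head transfers VERBATIM (`μ.map e⁻¹` is finite on
compacts with `μ`, Mathlib `IsFiniteMeasureOnCompacts.map`).
* §1 frame: `nonempty_isComplex_infinitePlace_complex`, `diagonal_two_neg_two_map_embedding`, **`exists_cayley_transport`** (the `≃ₜ*`, its value formula, the torus point, the integral identity).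
* §2 (β) the normalised ONE-ANGLE functional `F f ψ = (2 sin ψ) • ∫_{U(J)} f(↑↑(h · P t_z(ψ) P⁻¹ · h⁻¹)) dμ` (binder `hF` = ★ (K0±) p850353's text in functional form; any centre `z`, any `μ` finite
  on compacts): **`contDiffOn_cayley_orbitalIntegral_param`** (joint `C^∞` on `univ ×ˢ {sin ψ ≠ 0}`), **`fderiv_cayley_orbitalIntegral_param_apply`** (`∂_v` inside, every `ψ`),
  **`fderiv_iteratedDeriv_cayley_orbitalIntegral_param`** (`∂_v` past `∂_ψⁿ`, `sin ψ ≠ 0`) — ★ p851042 (1b)(1c)(1d) transported; and the JOINT-derivative forms ★ p851048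
  (B-trans) binds as `h2₁`∕`h2₂`: **`fderiv_cayley_orbitalIntegral_param_prod_apply`** (`D[(q,ψ) ↦ F(Θ_q)(ψ)](x)·(v,0) = F(∂_v Θ_{x.1})(x.2)`), **`fderiv_splitIntegral_param_prod_apply`** (split twin over ★ p851042 §2).  ((B-trans)∕(B-asm) absorb the tangential centre
  `z(q) = e^{i(θ₀+θ₂)∕2}` of ★ p851016's two-angle torus into the family, `g q X := f (q, z(q) • X)`; the class «jointly `C^∞`, one compact support» is stable under that.)
HONEST LABEL: HC_CM is proved only modulo the 7 printed citations (2 remaining named inputs: hLiu418 = `stmt-HodgeConjecture-24832`, h413 = `stmt-HodgeConjecture-24833`) until rung 0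
closes; frame bookkeeping over ★, count-neutral (letter-L1 (I₃) brick; pays nothing by itself).

## References
* [Varadarajan1977] V. S. Varadarajan, *Harmonic Analysis on Real Reductive Groups*, LNM 576 (1977), Part I §1.12.
* [HormanderALPDO1] L. Hörmander, *The Analysis of Linear Partial Differential Operators I*, 2nd ed. (1990), §1.1 Thm. 1.1.8, Thm. 1.1.9.
* [Rogawski1990] J. D. Rogawski, *Automorphic Representations of Unitary Groups in Three Variables*, Ann. of Math. Stud. 123 (1990), §8.2 pp. 119–123 (the Cayley frame).
* [PlatonovRapinchuk1994] V. Platonov, A. Rapinchuk, *Algebraic Groups and Number Theory* (1994), §2.3 (change of frame for unitary groups).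
* [Bouaziz1994IntegralesOrbitales] A. Bouaziz, *Intégrales orbitales sur les groupes de Lie réductifs*, Ann. Sci. ÉNS 27 (1994), §3.2 (I₃).
-/

set_option autoImplicit false

noncomputable section

/-! ## §1 Frame (0): a complex place of `ℂ`, the Cayley congruence onto `U(J)`, the transport identity -/

namespace Literature.NumberTheory.Automorphic

namespace UnitaryGroup

open _root_.MeasureTheory _root_.MeasureTheory.Measure _root_.Set _root_.Filter _root_.Topology _root_.Complex _root_.NumberField _root_.NumberField.InfinitePlace
open _root_.Literature.Analysis.Calculus _root_.Literature.NumberTheory.Automorphic.RankOneCasimir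
open scoped MatrixGroups ContDiff ComplexConjugate
open scoped Matrix.Norms.Operator

/-- **(0) The field `ℂ` has a complex infinite place** (the place of `RingHom.id ℂ`: complex conjugation is not the identity, `conj I ≠ I`) — so the tree's `(L, a, w)`-frame lemmas
(★ `isCompact_setOf_exists_conj_circleDiagonal_mem`, ★ p851042) instantiate at `L := ℂ`. [cite: PlatonovRapinchuk1994, §2.3] -/
theorem nonempty_isComplex_infinitePlace_complex : Nonempty {w : InfinitePlace ℂ // IsComplex w} := by
  refine ⟨⟨InfinitePlace.mk (RingHom.id ℂ), ?_⟩⟩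
  rw [InfinitePlace.isComplex_mk_iff, ComplexEmbedding.isReal_iff]
  intro h
  have hI := RingHom.congr_fun h I
  rw [ComplexEmbedding.conjugate_coe_eq, RingHom.id_apply, Complex.conj_I] at hI
  exact I_ne_zero (by linear_combination (-1 : ℂ) / 2 * hI)

/-- **(0) `σ_{w₀}(diag(2, −2)) = diag(2, −2)`** for any infinite place `w₀` of `ℂ` (a ring endomorphism of `ℂ` fixes `2` and `−2`). [cite: PlatonovRapinchuk1994, §2.3] -/
theorem diagonal_two_neg_two_map_embedding (w₀ : {w : InfinitePlace ℂ // IsComplex w}) :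
    (Matrix.diagonal ![(2 : ℂ), -2]).map (w₀.1.embedding : ℂ →+* ℂ) = Matrix.diagonal ![(2 : ℂ), -2] := by
  rw [Matrix.diagonal_map (map_zero _)]
  congr 1
  funext i
  fin_cases i
  · simpa using map_ofNat (w₀.1.embedding : ℂ →+* ℂ) 2
  · simpa using map_ofNat (w₀.1.embedding : ℂ →+* ℂ) 2

variable {J : Matrix (Fin 2) (Fin 2) ℂ} (hJ : J = (StdForm.antidiagonal 2).over ℂ)
  [MeasurableSpace ↥(unitaryGroupOfForm (starRingEnd ℂ) J)] [BorelSpace ↥(unitaryGroupOfForm (starRingEnd ℂ) J)]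
  {E : Type*} [NormedAddCommGroup E] [NormedSpace ℝ E] [CompleteSpace E]
  {Q : Type*} [NormedAddCommGroup Q] [NormedSpace ℝ Q] [FiniteDimensional ℝ Q]

omit [CompleteSpace E] in
include hJ in
/-- **(0) THE CAYLEY TRANSPORT PACKAGE.**  For a complex place `w₀` of `ℂ` there is a topological-group isomorphism `e : U(σ_{w₀} diag(2,−2))(ℂ) ≃ₜ* U(J)` with `e h′ = P h′ P⁻¹`,
`P = (1 1; 1 −1)` (★ `unitaryGroupOfFormCongrOfEq` along ★ `formCongr_cayleyTwo_of_eq_over` and (0)), carrying the torus point `diag(u)` to `P diag(u) P⁻¹` and, for every measure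
`μ` on `U(J)` and every `f`, **`∫_{U(J)} f(↑↑(h · P diag(u) P⁻¹ · h⁻¹)) dμ = ∫ (X ↦ f(P X P⁻¹))(↑↑(h′ diag(u) h′⁻¹)) d(μ.map e⁻¹)(h′)`** (★ `integral_comp_conj_transport`).
[cite: Rogawski1990, §8.2 p. 122] [cite: PlatonovRapinchuk1994, §2.3] -/
theorem exists_cayley_transport (w₀ : {w : InfinitePlace ℂ // IsComplex w})
    [MeasurableSpace ↥(unitaryGroupOfForm (starRingEnd ℂ) ((Matrix.diagonal ![(2 : ℂ), -2]).map (w₀.1.embedding : ℂ →+* ℂ)))]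
    [BorelSpace ↥(unitaryGroupOfForm (starRingEnd ℂ) ((Matrix.diagonal ![(2 : ℂ), -2]).map (w₀.1.embedding : ℂ →+* ℂ)))] :
    ∃ e : ↥(unitaryGroupOfForm (starRingEnd ℂ) ((Matrix.diagonal ![(2 : ℂ), -2]).map (w₀.1.embedding : ℂ →+* ℂ))) ≃ₜ* ↥(unitaryGroupOfForm (starRingEnd ℂ) J),
      (∀ h' : ↥(unitaryGroupOfForm (starRingEnd ℂ) ((Matrix.diagonal ![(2 : ℂ), -2]).map (w₀.1.embedding : ℂ →+* ℂ))),
        ((e h' : ↥(unitaryGroupOfForm (starRingEnd ℂ) J)) : GL (Fin 2) ℂ) =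
          Matrix.GeneralLinearGroup.mkOfDetNeZero !![(1 : ℂ), 1; 1, -1] det_cayleyTwo_ne_zero * (h' : GL (Fin 2) ℂ) *
            (Matrix.GeneralLinearGroup.mkOfDetNeZero !![(1 : ℂ), 1; 1, -1] det_cayleyTwo_ne_zero)⁻¹) ∧
      (∀ u : Fin 2 → Circle, (⟨Matrix.GeneralLinearGroup.mkOfDetNeZero !![(1 : ℂ), 1; 1, -1] det_cayleyTwo_ne_zero * circleDiagonal 2 u *
            (Matrix.GeneralLinearGroup.mkOfDetNeZero !![(1 : ℂ), 1; 1, -1] det_cayleyTwo_ne_zero)⁻¹, cayley_conj_circleDiagonal_mem_of_eq_over hJ u⟩ :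
            ↥(unitaryGroupOfForm (starRingEnd ℂ) J)) =
          e ⟨circleDiagonal 2 u, circleDiagonal_mem_archLocal_diagonal ℂ 2 ![(2 : ℂ), -2] w₀ u⟩) ∧
      ∀ (μ : Measure ↥(unitaryGroupOfForm (starRingEnd ℂ) J)) (f : Matrix (Fin 2) (Fin 2) ℂ → E) (u : Fin 2 → Circle),
        (∫ h : ↥(unitaryGroupOfForm (starRingEnd ℂ) J),
            f (((h * ⟨Matrix.GeneralLinearGroup.mkOfDetNeZero !![(1 : ℂ), 1; 1, -1] det_cayleyTwo_ne_zero * circleDiagonal 2 u *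
                  (Matrix.GeneralLinearGroup.mkOfDetNeZero !![(1 : ℂ), 1; 1, -1] det_cayleyTwo_ne_zero)⁻¹, cayley_conj_circleDiagonal_mem_of_eq_over hJ u⟩ * h⁻¹ :
                ↥(unitaryGroupOfForm (starRingEnd ℂ) J)) : GL (Fin 2) ℂ) : Matrix (Fin 2) (Fin 2) ℂ) ∂μ =
          ∫ h' : ↥(unitaryGroupOfForm (starRingEnd ℂ) ((Matrix.diagonal ![(2 : ℂ), -2]).map (w₀.1.embedding : ℂ →+* ℂ))),
            (fun X : Matrix (Fin 2) (Fin 2) ℂ => f (((Matrix.GeneralLinearGroup.mkOfDetNeZero !![(1 : ℂ), 1; 1, -1] det_cayleyTwo_ne_zero : GL (Fin 2) ℂ) : Matrix (Fin 2) (Fin 2) ℂ) *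
                X * (((Matrix.GeneralLinearGroup.mkOfDetNeZero !![(1 : ℂ), 1; 1, -1] det_cayleyTwo_ne_zero)⁻¹ : GL (Fin 2) ℂ) : Matrix (Fin 2) (Fin 2) ℂ)))
              (((h' * ⟨circleDiagonal 2 u, circleDiagonal_mem_archLocal_diagonal ℂ 2 ![(2 : ℂ), -2] w₀ u⟩ * h'⁻¹ :
                ↥(unitaryGroupOfForm (starRingEnd ℂ) ((Matrix.diagonal ![(2 : ℂ), -2]).map (w₀.1.embedding : ℂ →+* ℂ)))) : GL (Fin 2) ℂ) : Matrix (Fin 2) (Fin 2) ℂ)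
            ∂(μ.map e.symm)) := by
  have hform : formCongr (starRingEnd ℂ) (Matrix.GeneralLinearGroup.mkOfDetNeZero !![(1 : ℂ), 1; 1, -1] det_cayleyTwo_ne_zero) J =
      (Matrix.diagonal ![(2 : ℂ), -2]).map (w₀.1.embedding : ℂ →+* ℂ) := by
    rw [diagonal_two_neg_two_map_embedding]
    exact formCongr_cayleyTwo_of_eq_over hJ
  set e := unitaryGroupOfFormCongrOfEq (starRingEnd ℂ) (Matrix.GeneralLinearGroup.mkOfDetNeZero !![(1 : ℂ), 1; 1, -1] det_cayleyTwo_ne_zero) J _ hform with he_def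
  have he : ∀ h' : ↥(unitaryGroupOfForm (starRingEnd ℂ) ((Matrix.diagonal ![(2 : ℂ), -2]).map (w₀.1.embedding : ℂ →+* ℂ))),
      ((e h' : ↥(unitaryGroupOfForm (starRingEnd ℂ) J)) : GL (Fin 2) ℂ) =
        Matrix.GeneralLinearGroup.mkOfDetNeZero !![(1 : ℂ), 1; 1, -1] det_cayleyTwo_ne_zero * (h' : GL (Fin 2) ℂ) *
          (Matrix.GeneralLinearGroup.mkOfDetNeZero !![(1 : ℂ), 1; 1, -1] det_cayleyTwo_ne_zero)⁻¹ := fun _ => rfl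
  have hγ : ∀ u : Fin 2 → Circle, (⟨Matrix.GeneralLinearGroup.mkOfDetNeZero !![(1 : ℂ), 1; 1, -1] det_cayleyTwo_ne_zero * circleDiagonal 2 u *
        (Matrix.GeneralLinearGroup.mkOfDetNeZero !![(1 : ℂ), 1; 1, -1] det_cayleyTwo_ne_zero)⁻¹, cayley_conj_circleDiagonal_mem_of_eq_over hJ u⟩ :
        ↥(unitaryGroupOfForm (starRingEnd ℂ) J)) = e ⟨circleDiagonal 2 u, circleDiagonal_mem_archLocal_diagonal ℂ 2 ![(2 : ℂ), -2] w₀ u⟩ :=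
    fun u => Subtype.ext (he ⟨circleDiagonal 2 u, circleDiagonal_mem_archLocal_diagonal ℂ 2 ![(2 : ℂ), -2] w₀ u⟩).symm
  refine ⟨e, he, hγ, fun μ f u => ?_⟩
  rw [hγ u, integral_comp_conj_transport _ _ e _ he μ f]

/-! ## §2 (β) The normalised ONE-ANGLE functional on `U(J)`: `F f ψ = (2 sin ψ) • ∫_{U(J)} f(↑↑(h · P t_z(ψ) P⁻¹ · h⁻¹)) dμ` — ★ p851042 §1 transported -/

include hJ in
/-- **(β-b) ON `U(J)`: JOINT SMOOTHNESS OF THE NORMALISED ELLIPTIC FUNCTIONAL ON A SMOOTH FAMILY, CAYLEY TORUS.**  `μ` finite on compacts on `U(J)`, `z ∈ S¹`, `F` the bound functional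
with the ★ (K0±)-shaped text `hF` (`F f ψ = (2 sin ψ) • ∫_{U(J)} f(↑↑(h · P diag(z e^{iψ}, z e^{−iψ}) P⁻¹ · h⁻¹)) dμ`), `Θ` a family: **`(q, ψ) ↦ F(Θ_q)(ψ)` is `C^∞` on
`univ ×ˢ {sin ψ ≠ 0}`** (★ p851042 `contDiffOn_orbitalIntegral_param` for `Θ_P` on the engine carrier, transported by (0)). [cite: Varadarajan1977, I §1.12] [cite: HormanderALPDO1, Thm. 1.1.9]
[cite: Rogawski1990, §8.2 pp. 122–123] -/
theorem contDiffOn_cayley_orbitalIntegral_param (μ : Measure ↥(unitaryGroupOfForm (starRingEnd ℂ) J)) [IsFiniteMeasureOnCompacts μ]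
    (z : Circle) (F : (Matrix (Fin 2) (Fin 2) ℂ → E) → ℝ → E)
    (hF : ∀ (f : Matrix (Fin 2) (Fin 2) ℂ → E) (ψ : ℝ), F f ψ = (2 * Real.sin ψ) •
      ∫ h : ↥(unitaryGroupOfForm (starRingEnd ℂ) J),
        f (((h * ⟨Matrix.GeneralLinearGroup.mkOfDetNeZero !![(1 : ℂ), 1; 1, -1] det_cayleyTwo_ne_zero *
              circleDiagonal 2 ![z * Circle.exp ψ, z * Circle.exp (-ψ)] * (Matrix.GeneralLinearGroup.mkOfDetNeZero !![(1 : ℂ), 1; 1, -1] det_cayleyTwo_ne_zero)⁻¹,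
            cayley_conj_circleDiagonal_mem_of_eq_over hJ _⟩ * h⁻¹ : ↥(unitaryGroupOfForm (starRingEnd ℂ) J)) : GL (Fin 2) ℂ) : Matrix (Fin 2) (Fin 2) ℂ) ∂μ)
    (Θ : Q → Matrix (Fin 2) (Fin 2) ℂ → E) (hΘ : ContDiff ℝ ∞ (Function.uncurry Θ))
    (hΘc : ∃ C : Set (Matrix (Fin 2) (Fin 2) ℂ), IsCompact C ∧ ∀ (q : Q) (X : Matrix (Fin 2) (Fin 2) ℂ), X ∉ C → Θ q X = 0) :
    ContDiffOn ℝ ∞ (fun x : Q × ℝ => F (Θ x.1) x.2) ((Set.univ : Set Q) ×ˢ {ψ : ℝ | Real.sin ψ ≠ 0}) := by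
  obtain ⟨w₀⟩ := nonempty_isComplex_infinitePlace_complex
  letI : MeasurableSpace ↥(unitaryGroupOfForm (starRingEnd ℂ) ((Matrix.diagonal ![(2 : ℂ), -2]).map (w₀.1.embedding : ℂ →+* ℂ))) := borel _
  haveI : BorelSpace ↥(unitaryGroupOfForm (starRingEnd ℂ) ((Matrix.diagonal ![(2 : ℂ), -2]).map (w₀.1.embedding : ℂ →+* ℂ))) := ⟨rfl⟩
  obtain ⟨e, he, hγ, htr⟩ := exists_cayley_transport (E := E) hJ w₀
  haveI : IsFiniteMeasureOnCompacts (μ.map e.symm) := IsFiniteMeasureOnCompacts.map μ e.symm.toHomeomorph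
  have hα : ∀ i, (![(2 : ℂ), -2]) i ≠ 0 := by intro i; fin_cases i <;> simp
  obtain ⟨C, hC, h0⟩ := hΘc
  set Pm : Matrix (Fin 2) (Fin 2) ℂ := ((Matrix.GeneralLinearGroup.mkOfDetNeZero !![(1 : ℂ), 1; 1, -1] det_cayleyTwo_ne_zero : GL (Fin 2) ℂ) : Matrix (Fin 2) (Fin 2) ℂ) with hPm
  set Pi : Matrix (Fin 2) (Fin 2) ℂ := (((Matrix.GeneralLinearGroup.mkOfDetNeZero !![(1 : ℂ), 1; 1, -1] det_cayleyTwo_ne_zero)⁻¹ : GL (Fin 2) ℂ) : Matrix (Fin 2) (Fin 2) ℂ)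
    with hPi
  have hPiPm : Pi * Pm = 1 := by
    rw [hPi, hPm, ← Units.val_mul, inv_mul_cancel, Units.val_one]
  set ΘP : Q → Matrix (Fin 2) (Fin 2) ℂ → E := fun q X => Θ q (Pm * X * Pi) with hΘP
  have hΘP : ContDiff ℝ ∞ (Function.uncurry ΘP) :=
    hΘ.comp (contDiff_fst.prodMk ((contDiff_const.mul contDiff_snd).mul contDiff_const))
  have hΘPc : ∃ C' : Set (Matrix (Fin 2) (Fin 2) ℂ), IsCompact C' ∧ ∀ (q : Q) (X : Matrix (Fin 2) (Fin 2) ℂ), X ∉ C' → ΘP q X = 0 := by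
    refine ⟨(fun Y => Pi * Y * Pm) '' C, hC.image ((continuous_const.mul continuous_id).mul continuous_const), fun q X hX => h0 q _ fun hmem => hX ⟨_, hmem, ?_⟩⟩
    show Pi * (Pm * X * Pi) * Pm = X
    rw [← Matrix.mul_assoc, ← Matrix.mul_assoc, hPiPm, Matrix.one_mul, Matrix.mul_assoc, hPiPm, Matrix.mul_one]
  -- the engine-frame functional `F_D g ψ := (2 sin ψ) • ∫_{U(D)} g(↑↑(h′ t_z(ψ) h′⁻¹)) d(μ.map e⁻¹)` and `F f ψ = F_D (f ∘ Ad_P) ψ`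
  have hFD : ∀ (f : Matrix (Fin 2) (Fin 2) ℂ → E) (ψ : ℝ), F f ψ = (2 * Real.sin ψ) •
      ∫ h' : ↥(unitaryGroupOfForm (starRingEnd ℂ) ((Matrix.diagonal ![(2 : ℂ), -2]).map (w₀.1.embedding : ℂ →+* ℂ))),
        (fun X => f (Pm * X * Pi)) (((h' * ⟨circleDiagonal 2 ![z * Circle.exp ψ, z * Circle.exp (-ψ)], circleDiagonal_mem_archLocal_diagonal ℂ 2 ![(2 : ℂ), -2] w₀ _⟩ * h'⁻¹ :
          ↥(unitaryGroupOfForm (starRingEnd ℂ) ((Matrix.diagonal ![(2 : ℂ), -2]).map (w₀.1.embedding : ℂ →+* ℂ)))) : GL (Fin 2) ℂ) : Matrix (Fin 2) (Fin 2) ℂ) ∂(μ.map e.symm) := by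
    intro f ψ
    rw [hF, htr μ f]
  have key := contDiffOn_orbitalIntegral_param ℂ ![(2 : ℂ), -2] w₀ hα (μ.map e.symm) z
    (fun (g : Matrix (Fin 2) (Fin 2) ℂ → E) (ψ : ℝ) => (2 * Real.sin ψ) •
      ∫ h' : ↥(unitaryGroupOfForm (starRingEnd ℂ) ((Matrix.diagonal ![(2 : ℂ), -2]).map (w₀.1.embedding : ℂ →+* ℂ))),
        g (((h' * ⟨circleDiagonal 2 ![z * Circle.exp ψ, z * Circle.exp (-ψ)], circleDiagonal_mem_archLocal_diagonal ℂ 2 ![(2 : ℂ), -2] w₀ _⟩ * h'⁻¹ :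
          ↥(unitaryGroupOfForm (starRingEnd ℂ) ((Matrix.diagonal ![(2 : ℂ), -2]).map (w₀.1.embedding : ℂ →+* ℂ)))) : GL (Fin 2) ℂ) : Matrix (Fin 2) (Fin 2) ℂ) ∂(μ.map e.symm))
    (fun _ _ => rfl) ΘP hΘP hΘPc
  refine key.congr fun x _ => ?_
  exact hFD (Θ x.1) x.2

omit [CompleteSpace E] in
include hJ in
/-- **(β-c) ON `U(J)`: `∂_v` PASSES INTO THE NORMALISED FUNCTIONAL — `∂_v [q ↦ F(Θ_q)(ψ)](q) = F(∂_v Θ_q)(ψ)` for EVERY `ψ`** (★ p851042 `fderiv_orbitalIntegral_param_apply` transported;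
`∂_v Θ_P = (∂_v Θ)_P`). [cite: Varadarajan1977, I §1.12] [cite: HormanderALPDO1, Thm. 1.1.9] -/
theorem fderiv_cayley_orbitalIntegral_param_apply (μ : Measure ↥(unitaryGroupOfForm (starRingEnd ℂ) J)) [IsFiniteMeasureOnCompacts μ]
    (z : Circle) (F : (Matrix (Fin 2) (Fin 2) ℂ → E) → ℝ → E)
    (hF : ∀ (f : Matrix (Fin 2) (Fin 2) ℂ → E) (ψ : ℝ), F f ψ = (2 * Real.sin ψ) •
      ∫ h : ↥(unitaryGroupOfForm (starRingEnd ℂ) J),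
        f (((h * ⟨Matrix.GeneralLinearGroup.mkOfDetNeZero !![(1 : ℂ), 1; 1, -1] det_cayleyTwo_ne_zero *
              circleDiagonal 2 ![z * Circle.exp ψ, z * Circle.exp (-ψ)] * (Matrix.GeneralLinearGroup.mkOfDetNeZero !![(1 : ℂ), 1; 1, -1] det_cayleyTwo_ne_zero)⁻¹,
            cayley_conj_circleDiagonal_mem_of_eq_over hJ _⟩ * h⁻¹ : ↥(unitaryGroupOfForm (starRingEnd ℂ) J)) : GL (Fin 2) ℂ) : Matrix (Fin 2) (Fin 2) ℂ) ∂μ)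
    (Θ : Q → Matrix (Fin 2) (Fin 2) ℂ → E) (hΘ : ContDiff ℝ ∞ (Function.uncurry Θ))
    (hΘc : ∃ C : Set (Matrix (Fin 2) (Fin 2) ℂ), IsCompact C ∧ ∀ (q : Q) (X : Matrix (Fin 2) (Fin 2) ℂ), X ∉ C → Θ q X = 0)
    (q : Q) (v : Q) (ψ : ℝ) :
    fderiv ℝ (fun q' : Q => F (Θ q') ψ) q v = F (fun X => fderiv ℝ (fun q' : Q => Θ q' X) q v) ψ := by
  obtain ⟨w₀⟩ := nonempty_isComplex_infinitePlace_complex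
  letI : MeasurableSpace ↥(unitaryGroupOfForm (starRingEnd ℂ) ((Matrix.diagonal ![(2 : ℂ), -2]).map (w₀.1.embedding : ℂ →+* ℂ))) := borel _
  haveI : BorelSpace ↥(unitaryGroupOfForm (starRingEnd ℂ) ((Matrix.diagonal ![(2 : ℂ), -2]).map (w₀.1.embedding : ℂ →+* ℂ))) := ⟨rfl⟩
  obtain ⟨e, he, hγ, htr⟩ := exists_cayley_transport (E := E) hJ w₀
  haveI : IsFiniteMeasureOnCompacts (μ.map e.symm) := IsFiniteMeasureOnCompacts.map μ e.symm.toHomeomorph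
  have hα : ∀ i, (![(2 : ℂ), -2]) i ≠ 0 := by intro i; fin_cases i <;> simp
  obtain ⟨C, hC, h0⟩ := hΘc
  set Pm : Matrix (Fin 2) (Fin 2) ℂ := ((Matrix.GeneralLinearGroup.mkOfDetNeZero !![(1 : ℂ), 1; 1, -1] det_cayleyTwo_ne_zero : GL (Fin 2) ℂ) : Matrix (Fin 2) (Fin 2) ℂ) with hPm
  set Pi : Matrix (Fin 2) (Fin 2) ℂ := (((Matrix.GeneralLinearGroup.mkOfDetNeZero !![(1 : ℂ), 1; 1, -1] det_cayleyTwo_ne_zero)⁻¹ : GL (Fin 2) ℂ) : Matrix (Fin 2) (Fin 2) ℂ)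
    with hPi
  have hPiPm : Pi * Pm = 1 := by
    rw [hPi, hPm, ← Units.val_mul, inv_mul_cancel, Units.val_one]
  set ΘP : Q → Matrix (Fin 2) (Fin 2) ℂ → E := fun q X => Θ q (Pm * X * Pi) with hΘP
  have hΘP : ContDiff ℝ ∞ (Function.uncurry ΘP) :=
    hΘ.comp (contDiff_fst.prodMk ((contDiff_const.mul contDiff_snd).mul contDiff_const))
  have hΘPc : ∃ C' : Set (Matrix (Fin 2) (Fin 2) ℂ), IsCompact C' ∧ ∀ (q : Q) (X : Matrix (Fin 2) (Fin 2) ℂ), X ∉ C' → ΘP q X = 0 := by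
    refine ⟨(fun Y => Pi * Y * Pm) '' C, hC.image ((continuous_const.mul continuous_id).mul continuous_const), fun q X hX => h0 q _ fun hmem => hX ⟨_, hmem, ?_⟩⟩
    show Pi * (Pm * X * Pi) * Pm = X
    rw [← Matrix.mul_assoc, ← Matrix.mul_assoc, hPiPm, Matrix.one_mul, Matrix.mul_assoc, hPiPm, Matrix.mul_one]
  have hFD : ∀ (f : Matrix (Fin 2) (Fin 2) ℂ → E) (ψ : ℝ), F f ψ = (2 * Real.sin ψ) •
      ∫ h' : ↥(unitaryGroupOfForm (starRingEnd ℂ) ((Matrix.diagonal ![(2 : ℂ), -2]).map (w₀.1.embedding : ℂ →+* ℂ))),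
        (fun X => f (Pm * X * Pi)) (((h' * ⟨circleDiagonal 2 ![z * Circle.exp ψ, z * Circle.exp (-ψ)], circleDiagonal_mem_archLocal_diagonal ℂ 2 ![(2 : ℂ), -2] w₀ _⟩ * h'⁻¹ :
          ↥(unitaryGroupOfForm (starRingEnd ℂ) ((Matrix.diagonal ![(2 : ℂ), -2]).map (w₀.1.embedding : ℂ →+* ℂ)))) : GL (Fin 2) ℂ) : Matrix (Fin 2) (Fin 2) ℂ) ∂(μ.map e.symm) := by
    intro f ψ
    rw [hF, htr μ f]
  have key := fderiv_orbitalIntegral_param_apply ℂ ![(2 : ℂ), -2] w₀ hα (μ.map e.symm) z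
    (fun (g : Matrix (Fin 2) (Fin 2) ℂ → E) (ψ : ℝ) => (2 * Real.sin ψ) •
      ∫ h' : ↥(unitaryGroupOfForm (starRingEnd ℂ) ((Matrix.diagonal ![(2 : ℂ), -2]).map (w₀.1.embedding : ℂ →+* ℂ))),
        g (((h' * ⟨circleDiagonal 2 ![z * Circle.exp ψ, z * Circle.exp (-ψ)], circleDiagonal_mem_archLocal_diagonal ℂ 2 ![(2 : ℂ), -2] w₀ _⟩ * h'⁻¹ :
          ↥(unitaryGroupOfForm (starRingEnd ℂ) ((Matrix.diagonal ![(2 : ℂ), -2]).map (w₀.1.embedding : ℂ →+* ℂ)))) : GL (Fin 2) ℂ) : Matrix (Fin 2) (Fin 2) ℂ) ∂(μ.map e.symm))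
    (fun _ _ => rfl) ΘP hΘP hΘPc q v ψ
  have hfun : (fun q' : Q => F (Θ q') ψ) = fun q' : Q => (fun (g : Matrix (Fin 2) (Fin 2) ℂ → E) (ψ : ℝ) => (2 * Real.sin ψ) •
      ∫ h' : ↥(unitaryGroupOfForm (starRingEnd ℂ) ((Matrix.diagonal ![(2 : ℂ), -2]).map (w₀.1.embedding : ℂ →+* ℂ))),
        g (((h' * ⟨circleDiagonal 2 ![z * Circle.exp ψ, z * Circle.exp (-ψ)], circleDiagonal_mem_archLocal_diagonal ℂ 2 ![(2 : ℂ), -2] w₀ _⟩ * h'⁻¹ :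
          ↥(unitaryGroupOfForm (starRingEnd ℂ) ((Matrix.diagonal ![(2 : ℂ), -2]).map (w₀.1.embedding : ℂ →+* ℂ)))) : GL (Fin 2) ℂ) : Matrix (Fin 2) (Fin 2) ℂ) ∂(μ.map e.symm))
      (ΘP q') ψ := funext fun q' => hFD (Θ q') ψ
  rw [hfun, key]
  exact (hFD (fun X => fderiv ℝ (fun q' : Q => Θ q' X) q v) ψ).symm


include hJ in
/-- **(β-c′) THE JOINT-DERIVATIVE FORM (B-trans) ★ p851048 binds as `h2₁`**: at a point `x = (q, ψ)` with `sin ψ ≠ 0`, the derivative of the JOINT function `(q, ψ) ↦ F(Θ_q)(ψ)` along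
`(v, 0)` is `F(∂_v Θ_q)(ψ)` (★ p851003 `fderiv_slice_fst_apply` + (β-b) for differentiability + (β-c)). [cite: Varadarajan1977, I §1.12] [cite: HormanderALPDO1, Thm. 1.1.9] -/
theorem fderiv_cayley_orbitalIntegral_param_prod_apply (μ : Measure ↥(unitaryGroupOfForm (starRingEnd ℂ) J)) [IsFiniteMeasureOnCompacts μ]
    (z : Circle) (F : (Matrix (Fin 2) (Fin 2) ℂ → E) → ℝ → E)
    (hF : ∀ (f : Matrix (Fin 2) (Fin 2) ℂ → E) (ψ : ℝ), F f ψ = (2 * Real.sin ψ) •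
      ∫ h : ↥(unitaryGroupOfForm (starRingEnd ℂ) J),
        f (((h * ⟨Matrix.GeneralLinearGroup.mkOfDetNeZero !![(1 : ℂ), 1; 1, -1] det_cayleyTwo_ne_zero *
              circleDiagonal 2 ![z * Circle.exp ψ, z * Circle.exp (-ψ)] * (Matrix.GeneralLinearGroup.mkOfDetNeZero !![(1 : ℂ), 1; 1, -1] det_cayleyTwo_ne_zero)⁻¹,
            cayley_conj_circleDiagonal_mem_of_eq_over hJ _⟩ * h⁻¹ : ↥(unitaryGroupOfForm (starRingEnd ℂ) J)) : GL (Fin 2) ℂ) : Matrix (Fin 2) (Fin 2) ℂ) ∂μ)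
    (Θ : Q → Matrix (Fin 2) (Fin 2) ℂ → E) (hΘ : ContDiff ℝ ∞ (Function.uncurry Θ))
    (hΘc : ∃ C : Set (Matrix (Fin 2) (Fin 2) ℂ), IsCompact C ∧ ∀ (q : Q) (X : Matrix (Fin 2) (Fin 2) ℂ), X ∉ C → Θ q X = 0)
    (v : Q) {x : Q × ℝ} (hx : Real.sin x.2 ≠ 0) :
    fderiv ℝ (fun y : Q × ℝ => F (Θ y.1) y.2) x (v, (0 : ℝ)) = F (fun X => fderiv ℝ (fun q' : Q => Θ q' X) x.1 v) x.2 := by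
  have hU : IsOpen ((Set.univ : Set Q) ×ˢ {ψ : ℝ | Real.sin ψ ≠ 0}) := isOpen_univ.prod (isOpen_ne_fun Real.continuous_sin continuous_const)
  have hd : DifferentiableAt ℝ (fun y : Q × ℝ => F (Θ y.1) y.2) x :=
    ((contDiffOn_cayley_orbitalIntegral_param hJ μ z F hF Θ hΘ hΘc).contDiffAt (hU.mem_nhds (Set.mk_mem_prod (Set.mem_univ _) hx))).differentiableAt (by simp)
  rw [← fderiv_slice_fst_apply hd v]
  exact fderiv_cayley_orbitalIntegral_param_apply hJ μ z F hF Θ hΘ hΘc x.1 v x.2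

include hJ in
/-- **(β-d) HEAD ON `U(J)`: `∂_v` COMMUTES PAST THE NORMAL JETS** — for every `q, v`, every regular `ψ` (`sin ψ ≠ 0`) and every order `n`,
**`∂_v [q′ ↦ (F(Θ_{q′}))⁽ⁿ⁾(ψ)](q) = (F(∂_v Θ_q))⁽ⁿ⁾(ψ)`** (★ p851003 `fderiv_iteratedDeriv_slice_eq` on `univ ×ˢ {sin ≠ 0}` with (β-b) and (β-c)).  The family class is closed under `∂_v`
(★ `contDiff_uncurry_fderiv_apply`, ★ `forall_fderiv_apply_eq_zero_of_support`), so (B-trans) iterates this along every transversal adapted letter. [cite: Varadarajan1977, I §1.12]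
[cite: HormanderALPDO1, Thm. 1.1.8] [cite: Bouaziz1994IntegralesOrbitales, §3.2 (I₃)] -/
theorem fderiv_iteratedDeriv_cayley_orbitalIntegral_param (μ : Measure ↥(unitaryGroupOfForm (starRingEnd ℂ) J)) [IsFiniteMeasureOnCompacts μ]
    (z : Circle) (F : (Matrix (Fin 2) (Fin 2) ℂ → E) → ℝ → E)
    (hF : ∀ (f : Matrix (Fin 2) (Fin 2) ℂ → E) (ψ : ℝ), F f ψ = (2 * Real.sin ψ) •
      ∫ h : ↥(unitaryGroupOfForm (starRingEnd ℂ) J),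
        f (((h * ⟨Matrix.GeneralLinearGroup.mkOfDetNeZero !![(1 : ℂ), 1; 1, -1] det_cayleyTwo_ne_zero *
              circleDiagonal 2 ![z * Circle.exp ψ, z * Circle.exp (-ψ)] * (Matrix.GeneralLinearGroup.mkOfDetNeZero !![(1 : ℂ), 1; 1, -1] det_cayleyTwo_ne_zero)⁻¹,
            cayley_conj_circleDiagonal_mem_of_eq_over hJ _⟩ * h⁻¹ : ↥(unitaryGroupOfForm (starRingEnd ℂ) J)) : GL (Fin 2) ℂ) : Matrix (Fin 2) (Fin 2) ℂ) ∂μ)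
    (Θ : Q → Matrix (Fin 2) (Fin 2) ℂ → E) (hΘ : ContDiff ℝ ∞ (Function.uncurry Θ))
    (hΘc : ∃ C : Set (Matrix (Fin 2) (Fin 2) ℂ), IsCompact C ∧ ∀ (q : Q) (X : Matrix (Fin 2) (Fin 2) ℂ), X ∉ C → Θ q X = 0)
    (q : Q) (v : Q) {ψ : ℝ} (hψ : Real.sin ψ ≠ 0) (n : ℕ) :
    fderiv ℝ (fun q' : Q => iteratedDeriv n (F (Θ q')) ψ) q v = iteratedDeriv n (F (fun X => fderiv ℝ (fun q' : Q => Θ q' X) q v)) ψ := by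
  have hU : IsOpen ((Set.univ : Set Q) ×ˢ {ψ : ℝ | Real.sin ψ ≠ 0}) := isOpen_univ.prod (isOpen_ne_fun Real.continuous_sin continuous_const)
  have hG := contDiffOn_cayley_orbitalIntegral_param hJ μ z F hF Θ hΘ hΘc
  have hG₁ : ∀ y ∈ (Set.univ : Set Q) ×ˢ {ψ : ℝ | Real.sin ψ ≠ 0},
      fderiv ℝ (fun q' : Q => (fun x : Q × ℝ => F (Θ x.1) x.2) (q', y.2)) y.1 v = (fun x : Q × ℝ => F (fun X => fderiv ℝ (fun q' : Q => Θ q' X) x.1 v) x.2) y :=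
    fun y _ => fderiv_cayley_orbitalIntegral_param_apply hJ μ z F hF Θ hΘ hΘc y.1 v y.2
  exact fderiv_iteratedDeriv_slice_eq hU hG v hG₁ (x := (q, ψ)) (Set.mk_mem_prod (Set.mem_univ q) hψ) n

include hJ in
/-- **THE JOINT-DERIVATIVE FORM OF ★ p851042 (2b), as (B-trans) ★ p851048 binds it (`h2₂`)**: for the split half-chart reader, at every `x = (q, x₀)` the derivative of the JOINT function
`(q, x₀) ↦ Λ(Θ_q)(x₀)` along `(v, 0)` is `Λ(∂_v Θ_q)(x₀)` (★ p851003 `fderiv_slice_fst_apply` + ★ p851042 `contDiff_splitIntegral_param` ∕ `fderiv_splitIntegral_param_apply`).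
[cite: Varadarajan1977, I §1.12] [cite: HormanderALPDO1, Thm. 1.1.9] -/
theorem fderiv_splitIntegral_param_prod_apply {K : Subgroup ↥(unitaryGroupOfForm (starRingEnd ℂ) J)} (κ : Measure ↥K) (μN : Measure ↥(unipotentU (starRingEnd ℂ) J))
    (hK : IsCompact (K : Set ↥(unitaryGroupOfForm (starRingEnd ℂ) J))) [κ.IsHaarMeasure] [μN.IsHaarMeasure]
    (θ : ℝ) (Λ : (Matrix (Fin 2) (Fin 2) ℂ → E) → ℝ → E)
    (hΛ : ∀ (g : Matrix (Fin 2) (Fin 2) ℂ → E) (x : ℝ), Λ g x = ∫ p : ↥K × ↥(unipotentU (starRingEnd ℂ) J), g ((((((p.1 : ↥K) : ↥(unitaryGroupOfForm (starRingEnd ℂ) J)) * (((⟨hypBlockGL 0 θ, hypBlockGL_mem_of_eq_over hJ 0 θ⟩ : ↥(unitaryGroupOfForm (starRingEnd ℂ) J))) * ((⟨hypBlockGL (x / 2) 0, hypBlockGL_mem_of_eq_over hJ (x / 2) 0⟩ : ↥(unitaryGroupOfForm (starRingEnd ℂ) J))) * ((p.2 : ↥(unipotentU (starRingEnd ℂ)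 J)) : ↥(unitaryGroupOfForm (starRingEnd ℂ) J)) * ((⟨hypBlockGL (x / 2) 0, hypBlockGL_mem_of_eq_over hJ (x / 2) 0⟩ : ↥(unitaryGroupOfForm (starRingEnd ℂ) J)))) * ((p.1 : ↥K) : ↥(unitaryGroupOfForm (starRingEnd ℂ) J))⁻¹ : ↥(unitaryGroupOfForm (starRingEnd ℂ) J))) : GL (Fin 2) ℂ) : Matrix (Fin 2) (Fin 2) ℂ) ∂(κ.prod μN))
    (Θ : Q → Matrix (Fin 2) (Fin 2) ℂ → E) (hΘ : ContDiff ℝ ∞ (Function.uncurry Θ))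
    (hΘc : ∃ C : Set (Matrix (Fin 2) (Fin 2) ℂ), IsCompact C ∧ ∀ (q : Q) (X : Matrix (Fin 2) (Fin 2) ℂ), X ∉ C → Θ q X = 0)
    (v : Q) (x : Q × ℝ) :
    fderiv ℝ (fun y : Q × ℝ => Λ (Θ y.1) y.2) x (v, (0 : ℝ)) = Λ (fun X => fderiv ℝ (fun q' : Q => Θ q' X) x.1 v) x.2 := by
  have hd : DifferentiableAt ℝ (fun y : Q × ℝ => Λ (Θ y.1) y.2) x :=
    ((contDiff_splitIntegral_param hJ κ μN hK θ Λ hΛ Θ hΘ hΘc).differentiable (by simp)) x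
  rw [← fderiv_slice_fst_apply hd v]
  exact fderiv_splitIntegral_param_apply hJ κ μN hK θ Λ hΛ Θ hΘ hΘc x.1 v x.2

end UnitaryGroup

end Literature.NumberTheory.Automorphic

end
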